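import Mathlib
import Summits.Langlands.Langlands.Theses.ParityBlindBianchi
import Summits.Langlands.Langlands.Theorems.ParityBlindBianchiIcosahedralDescentLevelMain
import Summits.Langlands.Langlands.Theorems.ParityBlindBianchiIcosahedralDescentLevelBCStubAnchorDescentBC
import Summits.Langlands.Langlands.Theorems.ParityBlindBianchiIcosahedralDescentLevelBCStubReadOffBC
import Literature.NumberTheory.Automorphic.ArthurClozelFibresShiftKilling

/-!
# `IcosahedralDescentLevelBC` (stmt-Langlands-16852, D″BC of route ParityBlindBianchi) from the single
# named fact F4 — the line `Sketch` re-plumbed over the crux's antecedents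

The crux is `QuadraticDescentGL2 → QuadraticBaseChangeGL2 → IcosahedralDescentLevelR` by `rfl`.  D′R is
kernel-checked from the four Arthur–Clozel named facts F1–F4 (p111861,
`Theorems/ParityBlindBianchiIcosahedralDescentLevelMain.lean`).  Here the five call sites of F1
(`cuspidal_descent_cyclic`), F2 (`ArthurClozel1989_strongLifting_unramified`) and F3
(`baseChange_cyclic_cuspidal`) — all at `(n, F, E) = (2, ℚ, quadratic)` — are re-typed over the crux's own
antecedents `hQD : QuadraticDescentGL2` (anchor descent, landed stub `stub_anchorDescentBC`, p142981) and
clauses (a), (b) of `hQBC : QuadraticBaseChangeGL2` (cuspidality of `BC_K(π)` with the inert witness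
`t_{π,ℓ₁} = {1,1}`; split read-off, landed stub `stub_readOffBC`, p142990); every fact-free helper of the
landed line (`AuxPrime`, `Inert`, `Witness`, `CaseB`, `Transfer`, `FrobRoots`, `Fields`, `Compositum`,
`eventually_good`, `forall_or_forall_of_pairwise`, …) is reused by import.  What remains is exactly ONE
input: Arthur–Clozel Ch. 3 Thm 3.1 (fibres of quadratic base change) AT RANK 2, taken as the explicit
hypothesis `hfib2` (the `n := 2` slice of the tree's named fact `ArthurClozel_fibres_quadratic`,
undischarged; tree decomposition `ArthurClozel_fibres_quadratic_holds_of`).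

Main results: `pair_dichotomy_bc`, `exists_isPiOfArtinRep_of_uniform_bc` (the `ι`-free form),
`icosahedralDescentLevelBC_repaired`, and the crux BY NAME in two conditional forms —
`icosahedralDescentLevelBC_of_fibresTwo (hfib2 : <A–C 3.1 at rank 2>)` and
`icosahedralDescentLevelBC_of_fibres (hfib : ArthurClozel_fibres_quadratic)`.  Trust base of the latter:
exactly `{ArthurClozel_fibres_quadratic}` (`proof.conditional`); the item's own signature is NOT proved
unconditionally here (the fibre theorem is a genuine global rigidity input: it alone pins the sign of the
descended `π` at the `K₁`-inert primes uniformly, which no combination of the existence clauses QD/QBC and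
the tree's proved local facts supplies).
-/

-- `Summit.Langlands.Langlands.…`: the repeated path component is the tree's layout (D-0017).
set_option linter.dupNamespace false

noncomputable section

open scoped MatrixGroups NumberField Polynomial Classical
open NumberField IsDedekindDomain Field Filter
open Literature.NumberTheory.Automorphic Literature.NumberTheory.GaloisRepresentations
open Literature.NumberTheory.GaloisRepresentations.QuadraticFamily
open Summit.Langlands.Langlands.Theorems.IcosahedralQuadraticDescent
open Summit.Langlands.Langlands.Theorems.IcosahedralDescentLevel
open Summit.Langlands.Langlands.Theses.ParityBlindBianchi

namespace Summit.Langlands.Langlands.Theorems.IcosahedralDescentLevelBC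

/-- **The per-pair dichotomy over the clauses.**  Verbatim the landed `pair_dichotomy` (p111861) with
`hBC 2 ℚ K hprime …` replaced by clause (a) of `QuadraticBaseChangeGL2` (`finrank = 2`), the split
read-off by `stub_readOffBC` (p142990), and A–C 3.1 by its rank-2 slice, the hypothesis `hfib2`.
[folklore] -/
theorem pair_dichotomy_bc
    (hfib2 : ∀ (K M : Type) [Field K] [NumberField K] [Field M] [NumberField M] [Algebra K M],
      Module.finrank K M = 2 → ∀ (hK : isCompact_glFiniteIntegralLevel 2 K)
        (π π' : CuspidalAutomorphicRepData 2 K hK),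
        (∀ᶠ x : HeightOneSpectrum (𝓞 M) in Filter.cofinite,
          ∀ (w : HeightOneSpectrum (𝓞 K)) (α α' : Multiset ℂ), x.asIdeal.under (𝓞 K) = w.asIdeal →
            π.1.HasSatakeParamAt w α → π'.1.HasSatakeParamAt w α' →
              α.map (· ^ x.asIdeal.inertiaDeg (𝓞 K)) = α'.map (· ^ x.asIdeal.inertiaDeg (𝓞 K))) →
        (∀ᶠ w : HeightOneSpectrum (𝓞 K) in Filter.cofinite, ∀ α : Multiset ℂ,
            π.1.HasSatakeParamAt w α → π'.1.HasSatakeParamAt w α) ∨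
        (∀ᶠ w : HeightOneSpectrum (𝓞 K) in Filter.cofinite, ∀ α : Multiset ℂ,
            π.1.HasSatakeParamAt w α → π'.1.HasSatakeParamAt w (α.map (quadraticSign M w * ·))))
    (hQBC : QuadraticBaseChangeGL2)
    (ρ : FramedArtinRep ℚ 2) (S₀ : Finset ℕ) (h0 : (0 : ℕ) ∉ S₀)
    (hK : ∀ (K : Type) [Field K] [NumberField K], IsTotallyComplex K → Module.finrank ℚ K = 2 →
      (∃ v w : HeightOneSpectrum (𝓞 K), v ≠ w ∧ ((2 : ℕ) : 𝓞 K) ∈ v.asIdeal ∧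
        ((2 : ℕ) : 𝓞 K) ∈ w.asIdeal) →
      ∃ (hc : isCompact_glFiniteIntegralLevel 2 K) (P : CuspidalAutomorphicRepData 2 K hc),
        ∀ w : HeightOneSpectrum (𝓞 K), (∀ ℓ ∈ S₀, ((ℓ : ℕ) : 𝓞 K) ∉ w.asIdeal) →
          FrobSatakeCompatibleAt (ρ.restrictField K) P.1 w)
    (D₁ : ℕ) (hD₁ : D₁.Prime) [Fact (¬ IsSquare (-(D₁ : ℚ)))]
    (hK₁ : isCompact_glFiniteIntegralLevel 2 (sqrtNegField ℚ D₁))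
    (P₁ : CuspidalAutomorphicRepData 2 (sqrtNegField ℚ D₁) hK₁)
    (hP₁ : IsPiOfArtinRep (ρ.restrictField (sqrtNegField ℚ D₁)) P₁.1)
    (v₁ : HeightOneSpectrum (𝓞 ℚ)) (ℓ₁ : ℕ) (hℓ₁ : ℓ₁.Prime) (hℓ₁2 : ℓ₁ ≠ 2)
    (hℓ₁v : ((ℓ₁ : ℕ) : 𝓞 ℚ) ∈ v₁.asIdeal)
    (hQ : isCompact_glFiniteIntegralLevel 2 ℚ) (π πf : CuspidalAutomorphicRepData 2 ℚ hQ)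
    (hlift₁ : IsWeakBaseChangeLiftAE π.1 P₁.1) (hπv₁ : π.1.HasSatakeParamAt v₁ {1, 1})
    (htw : ∀ᶠ v : HeightOneSpectrum (𝓞 ℚ) in cofinite, ∀ α : Multiset ℂ,
      π.1.HasSatakeParamAt v α →
        πf.1.HasSatakeParamAt v (α.map (quadraticSign (sqrtNegField ℚ D₁) v * ·)))
    (v v' : HeightOneSpectrum (𝓞 ℚ)) (p p' : ℕ) (hp : p.Prime) (hp' : p'.Prime)
    (hpv : ((p : ℕ) : 𝓞 ℚ) ∈ v.asIdeal) (hp'v : ((p' : ℕ) : 𝓞 ℚ) ∈ v'.asIdeal)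
    (hp2 : p ≠ 2) (hp'2 : p' ≠ 2) (hpℓ : p ≠ ℓ₁) (hp'ℓ : p' ≠ ℓ₁)
    (hgood : ∀ ℓ ∈ S₀, ((ℓ : ℕ) : 𝓞 ℚ) ∉ v.asIdeal) (hgood' : ∀ ℓ ∈ S₀, ((ℓ : ℕ) : 𝓞 ℚ) ∉ v'.asIdeal)
    (hρv : ρ.IsUnramifiedAt v) (hρv' : ρ.IsUnramifiedAt v') :
    (FrobSatakeCompatibleAt ρ π.1 v ∧ FrobSatakeCompatibleAt ρ π.1 v') ∨
      (FrobSatakeCompatibleAt ρ πf.1 v ∧ FrobSatakeCompatibleAt ρ πf.1 v') := by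
  classical
  -- the auxiliary field `K = ℚ(√-D)`: `2, p, p'` split, `ℓ₁` inert, `D ≠ D₁`
  obtain ⟨D, hD, hDgt, h16, h8p, h8p', hns⟩ :=
    exists_auxPrime ℓ₁ hℓ₁ hℓ₁2 p p' hp hp' hp2 hp'2 hpℓ hp'ℓ D₁
  haveI hF : Fact (¬ IsSquare (-(D : ℚ))) := fact_not_isSquare_neg_natCast hD.pos
  haveI : Algebra.IsQuadraticExtension ℚ (sqrtNegField ℚ D) := ⟨finrank_sqrtNegField⟩
  haveI : IsGalois ℚ (sqrtNegField ℚ D) := inferInstance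
  have h2K : Module.finrank ℚ (sqrtNegField ℚ D) = 2 := finrank_sqrtNegField
  obtain ⟨hKc, P, hP⟩ := hK (sqrtNegField ℚ D) (isTotallyComplex_sqrtNegField hD.pos) h2K
    (exists_two_places_two_mem h16)
  have hPae : IsPiOfArtinRep (ρ.restrictField (sqrtNegField ℚ D)) P.1 := by
    filter_upwards [eventually_good S₀ h0 (sqrtNegField ℚ D)] with w hw using hP w hw
  -- `Q = BC_K(π)` cuspidal (clause (a)): the witness is `v₁` (`ℓ₁` inert in `K`, `t_{π,v₁} = {1,1}`)
  obtain ⟨u₁, hu₁⟩ := exists_above (E := sqrtNegField ℚ D) v₁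
  have hf₁ : u₁.asIdeal.inertiaDeg (𝓞 ℚ) = Module.finrank ℚ (sqrtNegField ℚ D) := by
    rw [h2K]; exact inertiaDeg_eq_two_of_nonsquare D ℓ₁ hℓ₁ hns v₁ hℓ₁v u₁ hu₁
  have hsum : (({1, 1} : Multiset ℂ)).sum ≠ 0 := by norm_num
  obtain ⟨Q, hQlift⟩ := hQBC.1 ℚ (sqrtNegField ℚ D) h2K hQ π
    ⟨v₁, u₁, {1, 1}, hu₁, hf₁, hπv₁, fun ζ hζ => map_neg_ne_of_sum_ne_zero hsum (by rwa [h2K] at hζ)⟩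
    hKc
  -- the compositum `L = K(√-D₁)`, quadratic over `K`
  have hne : D ≠ D₁ := (ne_of_lt hDgt).symm
  haveI : Fact (¬ IsSquare (-(D₁ : sqrtNegField ℚ D))) :=
    ⟨not_isSquare_neg_natCast_sqrtNegField D₁ D (not_isSquare_ratCast_mul hD hD₁ hne)⟩
  have h2L : Module.finrank (sqrtNegField ℚ D) (compositum D₁ D) = 2 := finrank_sqrtNegField
  -- Arthur–Clozel 3.1 over `K` w.r.t. `L`: hypothesis by transitivity through `K₁`
  have H := eventually_map_pow_eq_of_lifts (F := ℚ) (E := sqrtNegField ℚ D₁) (K := sqrtNegField ℚ D)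
    (M := compositum D₁ D) ρ (eventually_isUnramifiedAt ρ) hP₁ hPae hlift₁ hQlift (satake_unique P₁.1)
    (satake_unique P.1) (satake_unique Q.1) (satake_cofinite π.1)
  have H' : ∀ᶠ x : HeightOneSpectrum (𝓞 (compositum D₁ D)) in cofinite,
      ∀ (w : HeightOneSpectrum (𝓞 (sqrtNegField ℚ D))) (α α' : Multiset ℂ),
        x.asIdeal.under (𝓞 (sqrtNegField ℚ D)) = w.asIdeal → Q.1.HasSatakeParamAt w α →
          P.1.HasSatakeParamAt w α' →
            α.map (· ^ x.asIdeal.inertiaDeg (𝓞 (sqrtNegField ℚ D))) =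
              α'.map (· ^ x.asIdeal.inertiaDeg (𝓞 (sqrtNegField ℚ D))) :=
    H.mono fun x hx w α α' hxw hα hα' => (hx w α' α hxw hα' hα).symm
  -- the read-off at a good split place, for any cuspidal `x` of which `P` is a weak lift
  have readOff : ∀ (x : CuspidalAutomorphicRepData 2 ℚ hQ), IsWeakBaseChangeLiftAE x.1 P.1 →
      ∀ (u : HeightOneSpectrum (𝓞 ℚ)) (q : ℕ), q.Prime → ((q : ℕ) : 𝓞 ℚ) ∈ u.asIdeal →
        8 * q ∣ D + 1 → (∀ ℓ ∈ S₀, ((ℓ : ℕ) : 𝓞 ℚ) ∉ u.asIdeal) → ρ.IsUnramifiedAt u →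
          FrobSatakeCompatibleAt ρ x.1 u := by
    intro x hx u q hq hqu h8q hgu hρu
    obtain ⟨hunr, hdeg, -⟩ := split_of_dvd (D := D) hq hqu h8q
    exact stub_readOffBC hQBC ρ (sqrtNegField ℚ D) h2K hQ hKc x P hx u hunr hdeg hρu
      fun w hw => hP w ((good_iff_under S₀ _ w u hw).mpr hgu)
  rcases hfib2 (sqrtNegField ℚ D) (compositum D₁ D) h2L hKc Q P H' with hA | hB
  · -- Case A: `P` is a weak lift of `π`
    have hliftP : IsWeakBaseChangeLiftAE π.1 P.1 :=
      (hQlift.and hA).mono fun w ⟨h1, h2⟩ u α hu hα => h2 _ (h1 u α hu hα)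
    exact Or.inl ⟨readOff π hliftP v p hp hpv h8p hgood hρv,
      readOff π hliftP v' p' hp' hp'v h8p' hgood' hρv'⟩
  · -- Case B: `P` is a weak lift of `π♭` (splitting law for `L/K` against `K₁/ℚ`)
    have hliftP : IsWeakBaseChangeLiftAE πf.1 P.1 :=
      isWeakBaseChangeLiftAE_twist_of_caseB (sqrtNegField ℚ D₁) (sqrtNegField ℚ D) (compositum D₁ D) hQ hKc π πf Q P hQlift hB
        (eventually_quadraticSign_eq_pow D₁ D finrank_sqrtNegField h2L) htw
    exact Or.inr ⟨readOff πf hliftP v p hp hpv h8p hgood hρv,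
      readOff πf hliftP v' p' hp' hp'v h8p' hgood' hρv'⟩

/-- **Uniform quadratic descent, `ι`-free form, over the clauses** (the line's internal target):
verbatim the landed `exists_isPiOfArtinRep_of_uniform` (p111861) with the anchor step by
`stub_anchorDescentBC` (p142981) and the pairwise dichotomy by `pair_dichotomy_bc`; granted A–C 3.1 at
rank 2 (`hfib2`). [folklore] -/
theorem exists_isPiOfArtinRep_of_uniform_bc
    (hfib2 : ∀ (K M : Type) [Field K] [NumberField K] [Field M] [NumberField M] [Algebra K M],
      Module.finrank K M = 2 → ∀ (hK : isCompact_glFiniteIntegralLevel 2 K)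
        (π π' : CuspidalAutomorphicRepData 2 K hK),
        (∀ᶠ x : HeightOneSpectrum (𝓞 M) in Filter.cofinite,
          ∀ (w : HeightOneSpectrum (𝓞 K)) (α α' : Multiset ℂ), x.asIdeal.under (𝓞 K) = w.asIdeal →
            π.1.HasSatakeParamAt w α → π'.1.HasSatakeParamAt w α' →
              α.map (· ^ x.asIdeal.inertiaDeg (𝓞 K)) = α'.map (· ^ x.asIdeal.inertiaDeg (𝓞 K))) →
        (∀ᶠ w : HeightOneSpectrum (𝓞 K) in Filter.cofinite, ∀ α : Multiset ℂ,
            π.1.HasSatakeParamAt w α → π'.1.HasSatakeParamAt w α) ∨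
        (∀ᶠ w : HeightOneSpectrum (𝓞 K) in Filter.cofinite, ∀ α : Multiset ℂ,
            π.1.HasSatakeParamAt w α → π'.1.HasSatakeParamAt w (α.map (quadraticSign M w * ·))))
    (hQD : QuadraticDescentGL2) (hQBC : QuadraticBaseChangeGL2)
    (ρ : FramedArtinRep ℚ 2) (S₀ : Finset ℕ) (h0 : (0 : ℕ) ∉ S₀)
    (hK : ∀ (K : Type) [Field K] [NumberField K], IsTotallyComplex K → Module.finrank ℚ K = 2 →
      (∃ v w : HeightOneSpectrum (𝓞 K), v ≠ w ∧ ((2 : ℕ) : 𝓞 K) ∈ v.asIdeal ∧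
        ((2 : ℕ) : 𝓞 K) ∈ w.asIdeal) →
      ∃ (hc : isCompact_glFiniteIntegralLevel 2 K) (P : CuspidalAutomorphicRepData 2 K hc),
        ∀ w : HeightOneSpectrum (𝓞 K), (∀ ℓ ∈ S₀, ((ℓ : ℕ) : 𝓞 K) ∉ w.asIdeal) →
          FrobSatakeCompatibleAt (ρ.restrictField K) P.1 w) :
    ∃ (hQ : isCompact_glFiniteIntegralLevel 2 ℚ) (π : CuspidalAutomorphicRepData 2 ℚ hQ),
      IsPiOfArtinRep ρ π.1 := by
  classical
  have hQ : isCompact_glFiniteIntegralLevel 2 ℚ := isCompact_glFiniteIntegralLevel_holds 2 ℚ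
  -- the finite bad sets over `ℚ`
  have hgoodQ := eventually_good S₀ h0 ℚ
  have hram := eventually_isUnramifiedAt ρ
  have h2fin := finite_setOf_natCast_mem (n := 2) two_ne_zero
  -- the witness place `v₁ ∋ ℓ₁`
  set X₀ : Set (HeightOneSpectrum (𝓞 ℚ)) :=
    {v | ¬ (∀ ℓ ∈ S₀, ((ℓ : ℕ) : 𝓞 ℚ) ∉ v.asIdeal)} ∪ {v | ((2 : ℕ) : 𝓞 ℚ) ∈ v.asIdeal} with hX₀
  have hX₀fin : X₀.Finite := by
    refine Set.Finite.union ?_ h2fin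
    rw [Filter.eventually_cofinite] at hgoodQ
    exact hgoodQ
  obtain ⟨v₁, ℓ₁, hv₁X, hℓ₁, hℓ₁2, hℓ₁v, hρ₁, hroots₁⟩ := exists_witness_place ρ X₀ hX₀fin
  have hgood₁ : ∀ ℓ ∈ S₀, ((ℓ : ℕ) : 𝓞 ℚ) ∉ v₁.asIdeal := by
    by_contra h; exact hv₁X (Or.inl h)
  -- the anchor field `K₁ = ℚ(√-D₁)`, `16 ℓ₁ ∣ D₁ + 1`
  obtain ⟨D₁, hD₁, -, hD₁dvd⟩ := exists_prime_gt_and_dvd_succ (16 * ℓ₁) (mul_ne_zero (by norm_num) hℓ₁.ne_zero) 0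
  haveI hF₁ : Fact (¬ IsSquare (-(D₁ : ℚ))) := fact_not_isSquare_neg_natCast hD₁.pos
  haveI : Algebra.IsQuadraticExtension ℚ (sqrtNegField ℚ D₁) := ⟨finrank_sqrtNegField⟩
  haveI : IsGalois ℚ (sqrtNegField ℚ D₁) := inferInstance
  have h16 : 16 ∣ D₁ + 1 := (Dvd.intro _ rfl : 16 ∣ 16 * ℓ₁).trans hD₁dvd
  have h8ℓ : 8 * ℓ₁ ∣ D₁ + 1 := dvd_trans ⟨2, by ring⟩ hD₁dvd
  obtain ⟨hK₁, P₁, hP₁⟩ := hK (sqrtNegField ℚ D₁) (isTotallyComplex_sqrtNegField hD₁.pos)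
    finrank_sqrtNegField (exists_two_places_two_mem h16)
  -- `P₁ = π(ρ|K₁)` almost everywhere
  have hP₁ae : IsPiOfArtinRep (ρ.restrictField (sqrtNegField ℚ D₁)) P₁.1 := by
    filter_upwards [eventually_good S₀ h0 (sqrtNegField ℚ D₁)] with w hw using hP₁ w hw
  -- descent, exactness at `v₁`, twist
  obtain ⟨hunr₁, hdeg₁, -⟩ := split_of_dvd (D := D₁) hℓ₁ hℓ₁v h8ℓ
  have hcompat₁ : ∀ w : HeightOneSpectrum (𝓞 (sqrtNegField ℚ D₁)),
      w.asIdeal.under (𝓞 ℚ) = v₁.asIdeal →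
        FrobSatakeCompatibleAt (ρ.restrictField (sqrtNegField ℚ D₁)) P₁.1 w :=
    fun w hw => hP₁ w ((good_iff_under S₀ _ w v₁ hw).mpr hgood₁)
  obtain ⟨π, πf, hlift₁, hπv₁, htw⟩ := stub_anchorDescentBC hQD hQBC ρ (sqrtNegField ℚ D₁)
    finrank_sqrtNegField hK₁ P₁ hP₁ae v₁ hunr₁ hdeg₁ hcompat₁ hρ₁ hroots₁ hQ
  -- the good places and the pairwise dichotomy
  set G : Set (HeightOneSpectrum (𝓞 ℚ)) :=
    {v | (∀ ℓ ∈ S₀, ((ℓ : ℕ) : 𝓞 ℚ) ∉ v.asIdeal) ∧ ρ.IsUnramifiedAt v ∧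
      ((2 : ℕ) : 𝓞 ℚ) ∉ v.asIdeal ∧ ((ℓ₁ : ℕ) : 𝓞 ℚ) ∉ v.asIdeal} with hG
  have hGcof : ∀ᶠ v : HeightOneSpectrum (𝓞 ℚ) in cofinite, v ∈ G := by
    have h3 := finite_setOf_natCast_mem (n := ℓ₁) hℓ₁.ne_zero
    filter_upwards [hgoodQ, hram, h2fin.compl_mem_cofinite, h3.compl_mem_cofinite] with v a b c d
      using ⟨a, b, c, d⟩
  have key : ∀ v ∈ G, ∀ v' ∈ G,
      (FrobSatakeCompatibleAt ρ π.1 v ∧ FrobSatakeCompatibleAt ρ π.1 v') ∨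
        (FrobSatakeCompatibleAt ρ πf.1 v ∧ FrobSatakeCompatibleAt ρ πf.1 v') := by
    intro v hv v' hv'
    obtain ⟨hg, hρv, h2v, hℓv⟩ := hv
    obtain ⟨hg', hρv', h2v', hℓv'⟩ := hv'
    obtain ⟨p, hp, hpv⟩ := exists_prime_natCast_mem v
    obtain ⟨p', hp', hp'v⟩ := exists_prime_natCast_mem v'
    have ne_of : ∀ {q : ℕ} {u : HeightOneSpectrum (𝓞 ℚ)}, ((q : ℕ) : 𝓞 ℚ) ∈ u.asIdeal →
        ∀ {r : ℕ}, ((r : ℕ) : 𝓞 ℚ) ∉ u.asIdeal → q ≠ r := by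
      intro q u hq r hr hqr; exact hr (hqr ▸ hq)
    exact pair_dichotomy_bc hfib2 hQBC ρ S₀ h0 hK D₁ hD₁ hK₁ P₁ hP₁ae v₁ ℓ₁ hℓ₁ hℓ₁2 hℓ₁v hQ π πf
      hlift₁ hπv₁ htw v v' p p' hp hp' hpv hp'v (ne_of hpv h2v) (ne_of hp'v h2v') (ne_of hpv hℓv)
      (ne_of hp'v hℓv') hg hg' hρv hρv'
  rcases forall_or_forall_of_pairwise G _ _ key with hA | hB
  · exact ⟨hQ, π, hGcof.mono hA⟩
  · exact ⟨hQ, πf, hGcof.mono hB⟩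

/-- **The repaired descent D″ over the clauses**, in the summit's `2`-adic packaging: verbatim the
landed `icosahedralDescentLevel_repaired` (transfer through the contragredient and the `m = 1`
arithmetic dictionary, `exists_frobSatakeCompatible_of_model`) over
`exists_isPiOfArtinRep_of_uniform_bc`; granted A–C 3.1 at rank 2 (`hfib2`). [folklore] -/
theorem icosahedralDescentLevelBC_repaired
    (hfib2 : ∀ (K M : Type) [Field K] [NumberField K] [Field M] [NumberField M] [Algebra K M],
      Module.finrank K M = 2 → ∀ (hK : isCompact_glFiniteIntegralLevel 2 K)
        (π π' : CuspidalAutomorphicRepData 2 K hK),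
        (∀ᶠ x : HeightOneSpectrum (𝓞 M) in Filter.cofinite,
          ∀ (w : HeightOneSpectrum (𝓞 K)) (α α' : Multiset ℂ), x.asIdeal.under (𝓞 K) = w.asIdeal →
            π.1.HasSatakeParamAt w α → π'.1.HasSatakeParamAt w α' →
              α.map (· ^ x.asIdeal.inertiaDeg (𝓞 K)) = α'.map (· ^ x.asIdeal.inertiaDeg (𝓞 K))) →
        (∀ᶠ w : HeightOneSpectrum (𝓞 K) in Filter.cofinite, ∀ α : Multiset ℂ,
            π.1.HasSatakeParamAt w α → π'.1.HasSatakeParamAt w α) ∨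
        (∀ᶠ w : HeightOneSpectrum (𝓞 K) in Filter.cofinite, ∀ α : Multiset ℂ,
            π.1.HasSatakeParamAt w α → π'.1.HasSatakeParamAt w (α.map (quadraticSign M w * ·))))
    (hQD : QuadraticDescentGL2) (hQBC : QuadraticBaseChangeGL2)
    (ι : PadicAlgCl 2 ≃+* ℂ)
    (ρ : FramedGaloisRep ℚ ℂ 2) (S₀ : Finset ℕ) (h0 : (0 : ℕ) ∉ S₀)
    (hK : ∀ (K : Type) [Field K] [NumberField K], NumberField.IsTotallyComplex K →
      Module.finrank ℚ K = 2 →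
      (∃ v w : IsDedekindDomain.HeightOneSpectrum (NumberField.RingOfIntegers K), v ≠ w ∧
        ((2 : ℕ) : NumberField.RingOfIntegers K) ∈ v.asIdeal ∧
        ((2 : ℕ) : NumberField.RingOfIntegers K) ∈ w.asIdeal) →
      ∃ (σ : FramedGaloisRep K (PadicAlgCl 2) 2)
        (hcpt : isCompact_glFiniteIntegralLevel 2 K) (π : CuspidalAutomorphicRepData 2 K hcpt),
        (∀ (g : absoluteGaloisGroup K) (i j : Fin 2),
          ι ((σ g).val i j) = ((FramedGaloisRep.restrictField K ρ) g).val i j) ∧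
        ∀ w : IsDedekindDomain.HeightOneSpectrum (NumberField.RingOfIntegers K),
          (∀ ℓ ∈ S₀, ((ℓ : ℕ) : NumberField.RingOfIntegers K) ∉ w.asIdeal) →
            Summit.Langlands.SatakeFrobCompatibleAt ι π.1 σ w) :
    ∃ (hcpt : isCompact_glFiniteIntegralLevel 2 ℚ) (π : CuspidalAutomorphicRepData 2 ℚ hcpt),
      ∀ᶠ v : IsDedekindDomain.HeightOneSpectrum (NumberField.RingOfIntegers ℚ) in Filter.cofinite,
        ∃ α : Multiset ℂ, π.1.HasSatakeParamAt v α ∧ ρ.IsUnramifiedAt v ∧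
          ρ.HasFrobCharpolyAt v (satakePolynomial α) := by
  refine exists_isPiOfArtinRep_of_uniform_bc hfib2 hQD hQBC ρ S₀ h0 ?_
  intro K _ _ htc hdeg hsplit
  obtain ⟨σ, hcpt, π, hmodel, hπ⟩ := hK K htc hdeg hsplit
  obtain ⟨P, hP⟩ := exists_frobSatakeCompatible_of_model ι ρ S₀ K σ hcpt π hmodel hπ
  exact ⟨hcpt, P, hP⟩

/-- **The crux BY NAME, granted Arthur–Clozel Ch. 3 Thm 3.1 at rank 2.**  `IcosahedralDescentLevelBC`
unfolds (`rfl`) to `QuadraticDescentGL2 → QuadraticBaseChangeGL2 → IcosahedralDescentLevelR`, whose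
conclusion is `icosahedralDescentLevelBC_repaired` after `intro`.  CONDITIONAL: the hypothesis `hfib2` is
the `n := 2` slice of the tree's undischarged named fact `ArthurClozel_fibres_quadratic` (A–C Ch. 3
Thm 3.1; for `GL₂` also Langlands 1980), whose tree decomposition `ArthurClozel_fibres_quadratic_holds_of`
leaves Jacquet–Shalika (2.2) at `s = 1` and on `re s = 1` and multiplicity one for `GL₂` ((2.1), (2.3) at
rank ≤ 2, `η_{M/K}` and the unitary normalisation being theorems). [folklore] -/
theorem icosahedralDescentLevelBC_of_fibresTwo
    (hfib2 : ∀ (K M : Type) [Field K] [NumberField K] [Field M] [NumberField M] [Algebra K M],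
      Module.finrank K M = 2 → ∀ (hK : isCompact_glFiniteIntegralLevel 2 K)
        (π π' : CuspidalAutomorphicRepData 2 K hK),
        (∀ᶠ x : HeightOneSpectrum (𝓞 M) in Filter.cofinite,
          ∀ (w : HeightOneSpectrum (𝓞 K)) (α α' : Multiset ℂ), x.asIdeal.under (𝓞 K) = w.asIdeal →
            π.1.HasSatakeParamAt w α → π'.1.HasSatakeParamAt w α' →
              α.map (· ^ x.asIdeal.inertiaDeg (𝓞 K)) = α'.map (· ^ x.asIdeal.inertiaDeg (𝓞 K))) →
        (∀ᶠ w : HeightOneSpectrum (𝓞 K) in Filter.cofinite, ∀ α : Multiset ℂ,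
            π.1.HasSatakeParamAt w α → π'.1.HasSatakeParamAt w α) ∨
        (∀ᶠ w : HeightOneSpectrum (𝓞 K) in Filter.cofinite, ∀ α : Multiset ℂ,
            π.1.HasSatakeParamAt w α → π'.1.HasSatakeParamAt w (α.map (quadraticSign M w * ·)))) :
    IcosahedralDescentLevelBC :=
  fun hQD hQBC ι ρ _ _ ⟨S₀, h0, hK⟩ => icosahedralDescentLevelBC_repaired hfib2 hQD hQBC ι ρ S₀ h0 hK

/-- **The crux BY NAME from the single named fact F4** (`ArthurClozel_fibres_quadratic`, Arthur–Clozel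
Ch. 3 Thm 3.1, all ranks — used at `n = 2` only).  Trust base: exactly this one name
(`proof.conditional`); F1–F3 of the landed D′R proof are replaced by the crux's own antecedents.
[folklore] -/
theorem icosahedralDescentLevelBC_of_fibres (hfib : ArthurClozel_fibres_quadratic) :
    IcosahedralDescentLevelBC :=
  icosahedralDescentLevelBC_of_fibresTwo (hfib 2)

/-- **The crux BY NAME from the two `GL₂` leaves** — Jacquet–Shalika (2.2) at `s = 1` for
`GL₂ × GL₂` (`JacquetShalika1981_partialPairL_at_one_of_ne_conj` at rank 2, over all number fields and
automorphic measures) and multiplicity one for `GL₂` (`multiplicity_one_gl 2`) ONLY: the rank-2 fibre theorem they imply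
(`ArthurClozel_fibres_quadratic_two_of_gl2_at_one`, `Literature/…/ArthurClozelFibresShiftKilling`:
(2.3)₂ is the tree's theorem, the boundary fact (2.2′) is killed on `GL(1)` by central characters) fed
to `icosahedralDescentLevelBC_of_fibresTwo`.  CONDITIONAL: trust base exactly these two rank-2 named
facts (`proof.conditional`) — strictly inside that of `icosahedralDescentLevelBC_of_fibres` (the all-rank
F4, whose tree decomposition has four all-rank leaves). [folklore] -/
theorem icosahedralDescentLevelBC_of_gl2_at_one
    (h22 : ∀ {K : Type} [Field K] [NumberField K]
      {μ : MeasureTheory.Measure (AdelicGroupData.gl 2 K).automorphicQuotient}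
      [(AdelicGroupData.gl 2 K).IsAutomorphicMeasure μ],
      JacquetShalika1981_partialPairL_at_one_of_ne_conj (n := 2) (K := K) (μ := μ))
    (hm1 : ∀ (K : Type) [Field K] [NumberField K]
      (μ : MeasureTheory.Measure (AdelicGroupData.gl 2 K).automorphicQuotient)
      [(AdelicGroupData.gl 2 K).IsAutomorphicMeasure μ], multiplicity_one_gl 2 K μ) :
    IcosahedralDescentLevelBC :=
  icosahedralDescentLevelBC_of_fibresTwo (ArthurClozel_fibres_quadratic_two_of_gl2_at_one h22 hm1)

end Summit.Langlands.Langlands.Theorems.IcosahedralDescentLevelBC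

end
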